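import Summits.ABC.IUTFork.Conditional.AbcExpOfSigmaMassPointwise
import Summits.ABC.IUTFork.Conditional.AbcExpOfCor312SlackContent
import Summits.ABC.IUTFork.Repair.RHOffSigmaToleranceExponentFarDoor
import HarnessLib

/-!
# R-H ROUND 2 EXPONENT PROGRAMME — F5, THE ENDPOINT (rh-lead R19 shape (a), R21 «primary path = degree one»): «S on a FREE stratum Σ with retained
# `(j²−1)`-mass `≥ μ₀·M − Tol` at every content-locus datum + the θ-certificate cone cut ⟹ abc WITH EXPONENT `1/μ₀` ON EVERY FAR-FROM-CUSPS FAMILY»,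
# with the CONE-FREE twin at the Szpiro-bad rational data (explicit 2)

PROOF-ONLY file (0 definitions, 0 `Prop` facts, no instance, no notation) of the abc-iut cell, rung LADDER-ABC:A2.RESCUE.H; seat abc-iut-rh2-T-1 (gen 2,
«GO rh2-T-1 EXP-END»). 21-frontier 00:32:01Z: «type the loss sentence as ONE non-vacuous kernel theorem "S|Σ_data ⇒ abc with exponent 1/μ" on the genuine bed,
CUT on hregC, μ explicit in the datum»; rh-lead RULING R19 «EXPONENT RIGIDITY OF THE BELYI TRANSFER» (the printed [GenEll] Thm. 2.1 mechanism carries no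
`Λ > 1` to ALL points — F1 `GenEll.belyi_slope_not_pos`; an all-triples `ABCWithExponent (1/μ₀)` needs a NAMED hypothesis not in print) ⇒ THE CONCLUSION
OF RECORD is the far-from-cusps FAMILY `GenEll.ABCWithExponentOn {λ | λ ρ-far from the cusps at ∞ and 2} (1/μ₀)` (F1 p482093, rh-typ-7), and RULING R21
«F5 (a) PRIMARY PATH = DEGREE ONE» (abc-iut-rh2-xi-1: at `d = 1` the dilated display gives shape (a) DIRECTLY — `ρ⁵c³ ≤ (abc)_odd` on the family — no
`PartIIWith`, no transfer). The all-triples form at exponent `1/μ₀` under the named open hypothesis `GenEll_thm21_primesWith (1/μ₀)` (shape (b)) follows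
the general-degree Λ-port (abc-iut-rh2-exp-iut (B)/(C)) in a sequel; the all-triples forms at exponent `3/μ₀` are p483681 (`∃ C`-form) and xi-1's p484659
(`ABCWithExponent (3/μ)` socket); the R18 LABEL-CUT showcases (`κ = 1/2 ⟹` exponent `8` on the families, `24` for all triples) are the companion
`Conditional/AbcExpOfSigmaMassContentLabelCut.lean`.

COMPOSED BY NAME (nothing re-typed): this seat's p482104 (`displayWith_pointwise_of_licenceOn_mu_content_hregC`) and p477354
(`cor312UpTo_offTrivialMass_of_licenceOn_chosen`); abc-iut-rh2-q2-cond's `Cor312Slack.displayWith_inv_iff` (p481829); abc-iut-rh2-xi-1's p484356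
(`abcExpOn_farFromCusps_of_dilatedDisplay_degOne`) and p484659 (`abcExpOn_farFromCusps_share_of_offBound_degOne`, `abcWithExponent_three_div_share_of_offBound_degOne`);
rh-typ-7's F1 p482093 (`GenEll.ABCWithExponentOn`, `ABCWithExponent`, `NFPoint.FarFromCusps`).

WHAT IS TYPED (`μ₀ ∈ (0, 1]`, `Tol(P,l) = ((l+1)/4)·5·d*·l`, `σ(P,l,T)` a FREE cell set; `ρ ∈ (0, 1/2]`):
* §1 **`abcExpOn_farFromCusps_of_licenceOn_mu_content_hregC`** — explicit 3 = [LIC-C]·[MU-C]·[CONE-C] (p482104's binders VERBATIM) ⟹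
  `ABCWithExponentOn {P | P.FarFromCusps {2} ρ} (1/μ₀)` for every `ρ ∈ (0, 1/2]` — THE MORNING THEOREM: «abc with exponent `1/μ₀`, constants `C(ρ, ε)`,
  for the triples with `min(a,b) ≥ ρ·c` and `2^{v₂(abc)} ≤ 1/ρ`».
* §2 **`abcExpOn_farFromCusps_of_licenceOn_mu_szpiroBad_degOne`** — explicit 2 = [LIC₁-bad]·[MU₁-bad] (the two Σ-binders demanded ONLY at the Szpiro-bad
  admissible RATIONAL `(P, l)`, guard VERBATIM p452637 / p477900), CONE-FREE ⟹ the same families.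
HONEST FRAMING: CONDITIONAL; «`ABCWithExponentOn … (1/μ₀)` follows from these hypotheses AS TYPED», nothing more; [LIC]/[MU]/[CONE] are ASSUMPTION LABELS,
never asserted, refutable datum by datum (with `σ = Σ_data`, MIN-SLICE (iii): `μ(T) < 1` at every tabulated deep datum; NO tabulated datum lies on the
content locus; for σ FREE the empty stratum passes [MU-C] on a band iff `μ₀ < 1/4`, rh2-ref-3 (D)); NOT a uniform abc and NOT an exponent claim about
genuine data — whether they supply `μ(T) ≥ μ₀ > 0` where the certificate bites is OPEN (Q3 / round 3); nothing here asserts that abc is proved or refuted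
or that [IUTchIII] Cor. 3.12 / [IUTchIV] Thm. 1.10 holds or fails anywhere; no side taken on any author (Mochizuki / Scholze–Stix / Joshi / Dupuy–Hilado);
typed ≠ proved; instantiated ≠ endorsed. [cite: Mochizuki2012, IUTchIII Cor. 3.12 p. 173–174; IUTchIV Thm. 1.10 pp. 22–31, Cor. 2.2 (ii)–(iii) pp. 41–48]
[cite: MochizukiGenEll2010, Thm 2.1 p.11–13] [cite: DupuyHilado2025, §3.3, §3.9] [claim: Mochizuki2012, status: disputed] for every IUT locution. Axioms: standard.
-/

noncomputable section

open Set Function NumberField IsDedekindDomain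

namespace Summit.ABC.IUTFork.Conditional.SigmaMass

open Summit.ABC.IUTFork.Thm311 Summit.ABC.IUTFork.Thm311.Real Summit.ABC.IUTFork.Cor312 Summit.ABC.IUTFork.Cor312.Setting
  Summit.ABC.IUTFork.Cor312Vol Summit.ABC.IUTFork.Cor312Prov Literature.IUT.LogThetaLattice Literature.IUT.LogVolume
  Literature.IUT.HodgeTheaters Literature.IUT.LogVolume.ThetaData
  Literature.NumberTheory.DiophantineGeometry Literature.NumberTheory.DiophantineGeometry.GenEll Summit.ABC.ABC.Theorems
  Summit.ABC.IUTFork.Repair.RH.SigmaLicence Summit.ABC.IUTFork.Repair.RH.SigmaStrataEq Summit.ABC.IUTFork.Repair.RH.SigmaMass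
  Summit.ABC.IUTFork.Repair.RH.OffSigma Summit.ABC.IUTFork.Conditional

/-! ## §1 THE MORNING THEOREM (rh-lead R19 shape (a) / R21): [LIC-C]·[MU-C]·[CONE-C] ⟹ abc WITH EXPONENT `1/μ₀` ON EVERY FAR-FROM-CUSPS FAMILY -/

/-- **`abcExpOn_farFromCusps_of_licenceOn_mu_content_hregC` — F5 (a), THE ENDPOINT OF RECORD.** Explicit 3 = [LIC-C] 1 · [MU-C] 1 · [CONE-C] 1 (the binders
of this seat's `displayWith_pointwise_of_licenceOn_mu_content_hregC`, p482104, VERBATIM), for `μ₀ ∈ (0, 1]` and a FREE stratum `σ(P,l,T)`: IF at every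
admissible `(P, l)` on the content locus «`6·(1 + 20·d_mod/l)·(log-diff + log-cond) + 120·d*·l < log q^{∤{2,l}}`» and every genuine Θ-volume datum `T`
[LIC-C] the (xi-f) licence holds at the cells of `σ` for OUR typed hull at the chosen realising ideles, [MU-C] the discarded trivial mass satisfies
`B_triv(σᶜ) ≤ (1−μ₀)·T.gap + Tol(P,l)` (⟺ retained mass `mass(σ) ≥ μ₀·M − Tol`, `M = T.gap`), and [CONE-C] `hregC` holds (abc-iut-C-cert-1's binder VERBATIM),
THEN for every `ρ ∈ (0, 1/2]`: **`ABCWithExponentOn {λ | λ is ρ-far from the cusps at ∞ and 2} (1/μ₀)`**, i.e. `∀ ε > 0 ∃ C = C(ρ,ε) > 0`,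
`c < C·rad(abc)^{(1/μ₀)(1+ε)}` for every abc triple with `min(a, b) ≥ ρ·c` and `2^{v₂(abc)} ≤ 1/ρ` (rh-typ-7's `farFromCusps_ratPoint_triple_iff`) —
abc WITH EXPONENT `1/μ₀` ON EVERY CUSP-AVOIDING FAMILY, TRANSFER-FREE (R21 route: p482104's pointwise `1/μ₀`-dilated display at the RATIONAL
points `λ = a/c`, q2-cond's `displayWith_inv_iff`, xi-1's `RH.OffSigma.abcExpOn_farFromCusps_of_dilatedDisplay_degOne` p484356; no [GenEll] Belyi transfer,
no `K_V`, no `PartIIWith`). `μ₀ = 1`: exponent `1` on every family. `μ` explicit in the datum: `μ(T) = mass(Σ_data)/T.gap = Σ_v S(j₀(v))h_v/(S(l⋆)Σ_v h_v)`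
(p482365 + w-1 p477616); whether genuine data supply `μ(T) ≥ μ₀ > 0` on the content locus is OPEN (round 3: «drive μ → 1»); for σ FREE the EMPTY stratum
inhabits [MU-C] on a non-empty band iff `μ₀ < 1/4` (rh2-ref-3 (D); p482365 `…_empty_chosen_iff`) — quote with `μ₀ ≥ 1/4` or at the label cut (companion
file), where [LIC-C] carries the content. CONDITIONAL; «follows from these hypotheses AS TYPED», nothing more; no side taken on [IUTchIII] Cor. 3.12 or on
any author. [cite: Mochizuki2012, IUTchIV Thm. 1.10 pp. 22–31; Cor. 2.2 (ii)–(iii) pp. 41–48] [cite: Mochizuki2012, IUTchIII Cor. 3.12 p. 173–174]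
[cite: MochizukiGenEll2010, Thm 2.1 p.11–12] [claim: Mochizuki2012, status: disputed] -/
theorem abcExpOn_farFromCusps_of_licenceOn_mu_content_hregC {μ₀ : ℝ} (hμ₀ : 0 < μ₀) (hμ₁ : μ₀ ≤ 1)
    (M : ∀ (P : NFPoint) (l : ℕ) (T : Cor22.ThetaVolumeDatumAt P l), Type) [∀ P l T, Field (M P l T)] [∀ P l T, NumberField (M P l T)]
    (archPk : ∀ (P : NFPoint) (l : ℕ) (T : Cor22.ThetaVolumeDatumAt P l), letI := T.instFieldF; letI := T.instNumberFieldF; letI := T.instAlgebraF; letI := T.instFieldK;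
        letI := T.instNumberFieldK; letI := T.instAlgebraK; letI := T.instFieldFbar; letI := T.instAlgebraFbar;
        letI := T.instAlgebraKFbar; letI := T.instIsElliptic;
      ∀ (j : (thetaIndex (pilotDataOfK T.D T.K)).Label) (vQ : (thetaIndex (pilotDataOfK T.D T.K)).VQ), Set ((logShellsDH (pilotDataOfK T.D T.K) (analyticLogv T.K)).Packet j vQ))
    (archSub : ∀ (P : NFPoint) (l : ℕ) (T : Cor22.ThetaVolumeDatumAt P l), letI := T.instFieldF; letI := T.instNumberFieldF; letI := T.instAlgebraF; letI := T.instFieldK;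
        letI := T.instNumberFieldK; letI := T.instAlgebraK; letI := T.instFieldFbar; letI := T.instAlgebraFbar;
        letI := T.instAlgebraKFbar; letI := T.instIsElliptic;
      ∀ (j : (thetaIndex (pilotDataOfK T.D T.K)).Label) (v : (thetaIndex (pilotDataOfK T.D T.K)).V), Set ((logShellsDH (pilotDataOfK T.D T.K) (analyticLogv T.K)).Packet j ((thetaIndex (pilotDataOfK T.D T.K)).over v)))
    (Ψ : ∀ (P : NFPoint) (l : ℕ) (T : Cor22.ThetaVolumeDatumAt P l), letI := T.instFieldF; letI := T.instNumberFieldF; letI := T.instAlgebraF; letI := T.instFieldK;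
        letI := T.instNumberFieldK; letI := T.instAlgebraK; letI := T.instFieldFbar; letI := T.instAlgebraFbar;
        letI := T.instAlgebraKFbar; letI := T.instIsElliptic;
      ℤ → ∀ v : (thetaIndex (pilotDataOfK T.D T.K)).V, v ∈ (thetaIndex (pilotDataOfK T.D T.K)).Vbad → Set ((logShellsDH (pilotDataOfK T.D T.K) (analyticLogv T.K)).StarPacket v))
    (act : ∀ (P : NFPoint) (l : ℕ) (T : Cor22.ThetaVolumeDatumAt P l), letI := T.instFieldF; letI := T.instNumberFieldF; letI := T.instAlgebraF; letI := T.instFieldK;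
        letI := T.instNumberFieldK; letI := T.instAlgebraK; letI := T.instFieldFbar; letI := T.instAlgebraFbar;
        letI := T.instAlgebraKFbar; letI := T.instIsElliptic;
      ℤ → ∀ v : (thetaIndex (pilotDataOfK T.D T.K)).V, v ∈ (thetaIndex (pilotDataOfK T.D T.K)).Vbad → (logShellsDH (pilotDataOfK T.D T.K) (analyticLogv T.K)).StarPacket v → Module.End ℚ ((logShellsDH (pilotDataOfK T.D T.K) (analyticLogv T.K)).StarPacket v))
    (Mmod : ∀ (P : NFPoint) (l : ℕ) (T : Cor22.ThetaVolumeDatumAt P l), letI := T.instFieldF; letI := T.instNumberFieldF; letI := T.instAlgebraF; letI := T.instFieldK;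
        letI := T.instNumberFieldK; letI := T.instAlgebraK; letI := T.instFieldFbar; letI := T.instAlgebraFbar;
        letI := T.instAlgebraKFbar; letI := T.instIsElliptic;
      ℤ → ∀ j : (thetaIndex (pilotDataOfK T.D T.K)).LabelStar, Set ((logShellsDH (pilotDataOfK T.D T.K) (analyticLogv T.K)).GlobalPacket j.1))
    (region : ∀ (P : NFPoint) (l : ℕ) (T : Cor22.ThetaVolumeDatumAt P l), letI := T.instFieldF; letI := T.instNumberFieldF; letI := T.instAlgebraF; letI := T.instFieldK;
        letI := T.instNumberFieldK; letI := T.instAlgebraK; letI := T.instFieldFbar; letI := T.instAlgebraFbar;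
        letI := T.instAlgebraKFbar; letI := T.instIsElliptic;
      ℤ → ∀ j : (thetaIndex (pilotDataOfK T.D T.K)).LabelStar, FinDivisor (M P l T) → ∀ vQ : (thetaIndex (pilotDataOfK T.D T.K)).VQ, Set ((logShellsDH (pilotDataOfK T.D T.K) (analyticLogv T.K)).Packet j.1 vQ))
    (n : ∀ (P : NFPoint) (l : ℕ) (T : Cor22.ThetaVolumeDatumAt P l), ℤ)
    {HT : ∀ (P : NFPoint) (l : ℕ) (T : Cor22.ThetaVolumeDatumAt P l), Type} {LogLink : ∀ (P : NFPoint) (l : ℕ) (T : Cor22.ThetaVolumeDatumAt P l), HT P l T → HT P l T → Type}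
    {IsFull : ∀ (P : NFPoint) (l : ℕ) (T : Cor22.ThetaVolumeDatumAt P l), ∀ {s t : HT P l T}, LogLink P l T s t → Prop}
    (lat : ∀ (P : NFPoint) (l : ℕ) (T : Cor22.ThetaVolumeDatumAt P l), LGPGaussianLogThetaLattice (LogLink P l T) (IsFull P l T))
    {Frd : ∀ (P : NFPoint) (l : ℕ) (T : Cor22.ThetaVolumeDatumAt P l), Type} {IsoF : ∀ (P : NFPoint) (l : ℕ) (T : Cor22.ThetaVolumeDatumAt P l), Frd P l T → Frd P l T → Type} {Ob : ∀ (P : NFPoint) (l : ℕ) (T : Cor22.ThetaVolumeDatumAt P l), Frd P l T → Type}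
    {realify : ∀ (P : NFPoint) (l : ℕ) (T : Cor22.ThetaVolumeDatumAt P l), Frd P l T → Frd P l T} {Strip : ∀ (P : NFPoint) (l : ℕ) (T : Cor22.ThetaVolumeDatumAt P l), Type} {IsoS : ∀ (P : NFPoint) (l : ℕ) (T : Cor22.ThetaVolumeDatumAt P l), Strip P l T → Strip P l T → Type}
    {Mv : ∀ (P : NFPoint) (l : ℕ) (T : Cor22.ThetaVolumeDatumAt P l), letI := T.instFieldF; letI := T.instNumberFieldF; letI := T.instAlgebraF; letI := T.instFieldK;
        letI := T.instNumberFieldK; letI := T.instAlgebraK; letI := T.instFieldFbar; letI := T.instAlgebraFbar;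
        letI := T.instAlgebraKFbar; letI := T.instIsElliptic;
      ∀ v : (thetaIndex (pilotDataOfK T.D T.K)).V, v ∈ (thetaIndex (pilotDataOfK T.D T.K)).Vbad → Type}
    [∀ P l T v h, Monoid (Mv P l T v h)]
    (sig : ∀ (P : NFPoint) (l : ℕ) (T : Cor22.ThetaVolumeDatumAt P l), letI := T.instFieldF; letI := T.instNumberFieldF; letI := T.instAlgebraF; letI := T.instFieldK;
        letI := T.instNumberFieldK; letI := T.instAlgebraK; letI := T.instFieldFbar; letI := T.instAlgebraFbar;
        letI := T.instAlgebraKFbar; letI := T.instIsElliptic;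
      GlobalLGPFrobenioidSignature (thetaIndex (pilotDataOfK T.D T.K)).lstar (thetaIndex (pilotDataOfK T.D T.K)).V (· ∈ (thetaIndex (pilotDataOfK T.D T.K)).Vbad) (Frd P l T) (IsoF P l T) (Ob P l T) (realify P l T)
        (Strip P l T) (IsoS P l T) (Mv P l T))
    (split : ∀ (P : NFPoint) (l : ℕ) (T : Cor22.ThetaVolumeDatumAt P l), SplittingMonoids (Mv P l T))
    {ObΔ : ∀ (P : NFPoint) (l : ℕ) (T : Cor22.ThetaVolumeDatumAt P l), Type} {N : ∀ (P : NFPoint) (l : ℕ) (T : Cor22.ThetaVolumeDatumAt P l), letI := T.instFieldF; letI := T.instNumberFieldF; letI := T.instAlgebraF; letI := T.instFieldK;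
        letI := T.instNumberFieldK; letI := T.instAlgebraK; letI := T.instFieldFbar; letI := T.instAlgebraFbar;
        letI := T.instAlgebraKFbar; letI := T.instIsElliptic;
      ∀ v : (thetaIndex (pilotDataOfK T.D T.K)).V, v ∈ (thetaIndex (pilotDataOfK T.D T.K)).Vbad → Type}
    [∀ P l T v h, Monoid (N P l T v h)] (qData : ∀ (P : NFPoint) (l : ℕ) (T : Cor22.ThetaVolumeDatumAt P l), QPilotData (ObΔ P l T) (N P l T))
    -- the FREE stratum: a cell set at every genuine datum
    (σ : ∀ (P : NFPoint) (l : ℕ) (T : Cor22.ThetaVolumeDatumAt P l), letI := T.instFieldF; letI := T.instNumberFieldF; letI := T.instAlgebraF; letI := T.instFieldK;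
        letI := T.instNumberFieldK; letI := T.instAlgebraK; letI := T.instFieldFbar; letI := T.instAlgebraFbar;
        letI := T.instAlgebraKFbar; letI := T.instIsElliptic;
      Set (Fin (thetaIndex (pilotDataOfK T.D T.K)).lstar × (thetaIndex (pilotDataOfK T.D T.K)).VQ))
    -- [LIC-C] «S on Σ» on the content locus: the (xi-f) licence at the cells of `σ`, OUR typed hull, chosen realising ideles
    (hLic : ∀ P : NFPoint, P ∈ UP → ∀ l : ℕ, l.Prime → 5 ≤ l →
      Cor22.AdmitsCore P → Cor22.CondP2 P l → Cor22.CondP5 P l → Cor22.CondP6 P l →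
      6 * ((1 + 20 * (Cor22.dmod P : ℝ) / l) * (P.logDiff + Cor22.logCondAvoid P {2, l}))
          + 120 * (2 ^ 12 * 3 ^ 3 * 5 * (Cor22.dmod P : ℝ) * l) < Cor22.logQAvoid P {2, l} →
      ∀ T : Cor22.ThetaVolumeDatumAt P l, letI := T.instFieldF; letI := T.instNumberFieldF; letI := T.instAlgebraF; letI := T.instFieldK;
        letI := T.instNumberFieldK; letI := T.instAlgebraK; letI := T.instFieldFbar; letI := T.instAlgebraFbar;
        letI := T.instAlgebraKFbar; letI := T.instIsElliptic;
      LicenceOn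
        (settingPrVolSharp (pilotDataOfK T.D T.K) (logvAnalytic_analyticLogv (F := T.K)) (M P l T) (archPk P l T) (archSub P l T) (Ψ P l T)
          (act P l T) (Mmod P l T) (region P l T) (n P l T) (lat P l T) (sig P l T) (split P l T) (qData P l T)
          (exists_realising_qIdeles_pilotDataOfK T.D).choose
          (exists_realising_thetaIdeles_pilotDataOfK T.D).choose
          (exists_realising_qIdeles_pilotDataOfK T.D).choose_spec.1
          (exists_realising_qIdeles_pilotDataOfK T.D).choose_spec.2.1) (σ P l T))
    -- [MU-C] the RELATIVE tolerance there: `B_triv(σᶜ) ≤ (1−μ₀)·T.gap + Tol(P,l)` (⟺ mass(σ) ≥ μ₀·T.gap − Tol(P,l)), xi-1's `OffSigmaTolerance` VERBATIM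
    (hMu : ∀ P : NFPoint, P ∈ UP → ∀ l : ℕ, l.Prime → 5 ≤ l →
      Cor22.AdmitsCore P → Cor22.CondP2 P l → Cor22.CondP5 P l → Cor22.CondP6 P l →
      6 * ((1 + 20 * (Cor22.dmod P : ℝ) / l) * (P.logDiff + Cor22.logCondAvoid P {2, l}))
          + 120 * (2 ^ 12 * 3 ^ 3 * 5 * (Cor22.dmod P : ℝ) * l) < Cor22.logQAvoid P {2, l} →
      ∀ T : Cor22.ThetaVolumeDatumAt P l, letI := T.instFieldF; letI := T.instNumberFieldF; letI := T.instAlgebraF; letI := T.instFieldK;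
        letI := T.instNumberFieldK; letI := T.instAlgebraK; letI := T.instFieldFbar; letI := T.instAlgebraFbar;
        letI := T.instAlgebraKFbar; letI := T.instIsElliptic;
      OffSigmaTolerance (1 - μ₀) (tol P l) T
        (offTrivialMass
          (settingPrVolSharp (pilotDataOfK T.D T.K) (logvAnalytic_analyticLogv (F := T.K)) (M P l T) (archPk P l T) (archSub P l T) (Ψ P l T)
          (act P l T) (Mmod P l T) (region P l T) (n P l T) (lat P l T) (sig P l T) (split P l T) (qData P l T)
          (exists_realising_qIdeles_pilotDataOfK T.D).choose
          (exists_realising_thetaIdeles_pilotDataOfK T.D).choose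
          (exists_realising_qIdeles_pilotDataOfK T.D).choose_spec.1
          (exists_realising_qIdeles_pilotDataOfK T.D).choose_spec.2.1) (σ P l T)))
    -- [CONE-C] abc-iut-C-cert-1's `hregC` VERBATIM
    (hregC : ∀ P : NFPoint, P ∈ UP → ∀ l : ℕ, l.Prime → 5 ≤ l →
      Cor22.AdmitsCore P → Cor22.CondP2 P l → Cor22.CondP5 P l → Cor22.CondP6 P l →
      6 * ((1 + 20 * (Cor22.dmod P : ℝ) / l) * (P.logDiff + Cor22.logCondAvoid P {2, l}))
          + 120 * (2 ^ 12 * 3 ^ 3 * 5 * (Cor22.dmod P : ℝ) * l) < Cor22.logQAvoid P {2, l} →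
      ∀ T : Cor22.ThetaVolumeDatumAt P l,
        (letI := T.instFieldF; letI := T.instNumberFieldF; letI := T.instAlgebraF; letI := T.instFieldK
         letI := T.instNumberFieldK; letI := T.instAlgebraK; letI := T.instFieldFbar; letI := T.instAlgebraFbar
         letI := T.instAlgebraKFbar; letI := T.instIsElliptic
         ¬ (∀ p ∈ T.I.supportPrimes, ∀ v w : placesOver (fieldOfModuli T.E) p,
            (Summit.ABC.IUTFork.DHData.ofInput T.I).logQloc p v = (Summit.ABC.IUTFork.DHData.ofInput T.I).logQloc p w)) →
        T.HullEstimateOf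
          (((l : ℝ) + 1) / 4 *
            ((1 + 12 * (Cor22.dmod P : ℝ) / l) * (P.logDiff + Cor22.logCondAvoid P {2, l})
              + 2 * Real.log l + 52
              + 20 / 3 * Real.log (((2 ^ 12 * 3 ^ 3 * 5 * Cor22.dmod P : ℕ) : ℝ) * (l : ℝ))
                * (Nat.primeCounting (2 ^ 12 * 3 ^ 3 * 5 * Cor22.dmod P * l) : ℝ))))
    {ρ : ℝ} (h0 : 0 < ρ) (h2 : ρ ≤ 1 / 2) :
    ABCWithExponentOn {P : NFPoint | P.FarFromCusps ({2} : Finset ℕ) ρ} (1 / μ₀) :=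
  Repair.RH.OffSigma.abcExpOn_farFromCusps_of_dilatedDisplay_degOne hμ₀ hμ₁
    (fun η hη P hP _ l hl h5 hcore hP2 hP5 h6 => (Cor312Slack.displayWith_inv_iff hμ₀).1
      (displayWith_pointwise_of_licenceOn_mu_content_hregC hμ₀ hμ₁ M archPk archSub Ψ act Mmod region n lat sig split qData σ
        hLic hMu hregC η hη P hP l hl h5 hcore hP2 hP5 h6)) h0 h2

/-! ## §2 CONE-FREE, DEGREE ONE: [LIC₁-bad]·[MU₁-bad] at the Szpiro-bad RATIONAL data ALONE ⟹ the same far-from-cusps families (explicit 2) -/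

/-- **`abcExpOn_farFromCusps_of_licenceOn_mu_szpiroBad_degOne` — F5 (a), CONE-FREE FORM.** Explicit 2 = [LIC₁-bad] 1 · [MU₁-bad] 1 (NO cone binder:
at `d_mod = 1` the hull-volume estimate is abc-iut-S3's THEOREM and the Szpiro-good data are abc-iut-c312-d1's theorem, inside xi-1's door): IF at every
SZPIRO-BAD admissible RATIONAL `(P, l)` (guard of `Cor22.forall_cor312Of_of_szpiroBad` VERBATIM) and every genuine Θ-volume datum `T` the (xi-f) licence
holds on the FREE stratum `σ(P,l,T)` (OUR hull, chosen ideles) and `B_triv(σᶜ) ≤ (1−μ₀)·T.gap + Tol(P,l)` (`μ₀ ∈ (0,1]`), THEN for every `ρ ∈ (0, 1/2]`: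
**`ABCWithExponentOn {λ ρ-far from the cusps at ∞, 2} (1/μ₀)`** — this seat's `cor312UpTo_offTrivialMass_of_licenceOn_chosen` (p477354) fed as
`B := B_triv(σᶜ)` into abc-iut-rh2-xi-1's `RH.OffSigma.abcExpOn_farFromCusps_share_of_offBound_degOne` (p484659). CONDITIONAL; «follows AS TYPED»; [LIC₁-bad] /
[MU₁-bad] are assumption labels refutable datum by datum; nothing asserted about genuine data; no side taken on [IUTchIII] Cor. 3.12 or on any author.
[cite: Mochizuki2012, IUTchIV Cor. 2.2 (ii)–(iii) pp. 41–48] [cite: Mochizuki2012, IUTchIII Cor. 3.12 p. 173–174] [cite: MochizukiGenEll2010, Thm 2.1 p.11–12]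
[claim: Mochizuki2012, status: disputed] -/
theorem abcExpOn_farFromCusps_of_licenceOn_mu_szpiroBad_degOne {μ₀ : ℝ} (hμ₀ : 0 < μ₀) (hμ₁ : μ₀ ≤ 1)
    (M : ∀ (P : NFPoint) (l : ℕ) (T : Cor22.ThetaVolumeDatumAt P l), Type) [∀ P l T, Field (M P l T)] [∀ P l T, NumberField (M P l T)]
    (archPk : ∀ (P : NFPoint) (l : ℕ) (T : Cor22.ThetaVolumeDatumAt P l), letI := T.instFieldF; letI := T.instNumberFieldF; letI := T.instAlgebraF; letI := T.instFieldK;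
        letI := T.instNumberFieldK; letI := T.instAlgebraK; letI := T.instFieldFbar; letI := T.instAlgebraFbar;
        letI := T.instAlgebraKFbar; letI := T.instIsElliptic;
      ∀ (j : (thetaIndex (pilotDataOfK T.D T.K)).Label) (vQ : (thetaIndex (pilotDataOfK T.D T.K)).VQ), Set ((logShellsDH (pilotDataOfK T.D T.K) (analyticLogv T.K)).Packet j vQ))
    (archSub : ∀ (P : NFPoint) (l : ℕ) (T : Cor22.ThetaVolumeDatumAt P l), letI := T.instFieldF; letI := T.instNumberFieldF; letI := T.instAlgebraF; letI := T.instFieldK;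
        letI := T.instNumberFieldK; letI := T.instAlgebraK; letI := T.instFieldFbar; letI := T.instAlgebraFbar;
        letI := T.instAlgebraKFbar; letI := T.instIsElliptic;
      ∀ (j : (thetaIndex (pilotDataOfK T.D T.K)).Label) (v : (thetaIndex (pilotDataOfK T.D T.K)).V), Set ((logShellsDH (pilotDataOfK T.D T.K) (analyticLogv T.K)).Packet j ((thetaIndex (pilotDataOfK T.D T.K)).over v)))
    (Ψ : ∀ (P : NFPoint) (l : ℕ) (T : Cor22.ThetaVolumeDatumAt P l), letI := T.instFieldF; letI := T.instNumberFieldF; letI := T.instAlgebraF; letI := T.instFieldK;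
        letI := T.instNumberFieldK; letI := T.instAlgebraK; letI := T.instFieldFbar; letI := T.instAlgebraFbar;
        letI := T.instAlgebraKFbar; letI := T.instIsElliptic;
      ℤ → ∀ v : (thetaIndex (pilotDataOfK T.D T.K)).V, v ∈ (thetaIndex (pilotDataOfK T.D T.K)).Vbad → Set ((logShellsDH (pilotDataOfK T.D T.K) (analyticLogv T.K)).StarPacket v))
    (act : ∀ (P : NFPoint) (l : ℕ) (T : Cor22.ThetaVolumeDatumAt P l), letI := T.instFieldF; letI := T.instNumberFieldF; letI := T.instAlgebraF; letI := T.instFieldK;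
        letI := T.instNumberFieldK; letI := T.instAlgebraK; letI := T.instFieldFbar; letI := T.instAlgebraFbar;
        letI := T.instAlgebraKFbar; letI := T.instIsElliptic;
      ℤ → ∀ v : (thetaIndex (pilotDataOfK T.D T.K)).V, v ∈ (thetaIndex (pilotDataOfK T.D T.K)).Vbad → (logShellsDH (pilotDataOfK T.D T.K) (analyticLogv T.K)).StarPacket v → Module.End ℚ ((logShellsDH (pilotDataOfK T.D T.K) (analyticLogv T.K)).StarPacket v))
    (Mmod : ∀ (P : NFPoint) (l : ℕ) (T : Cor22.ThetaVolumeDatumAt P l), letI := T.instFieldF; letI := T.instNumberFieldF; letI := T.instAlgebraF; letI := T.instFieldK;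
        letI := T.instNumberFieldK; letI := T.instAlgebraK; letI := T.instFieldFbar; letI := T.instAlgebraFbar;
        letI := T.instAlgebraKFbar; letI := T.instIsElliptic;
      ℤ → ∀ j : (thetaIndex (pilotDataOfK T.D T.K)).LabelStar, Set ((logShellsDH (pilotDataOfK T.D T.K) (analyticLogv T.K)).GlobalPacket j.1))
    (region : ∀ (P : NFPoint) (l : ℕ) (T : Cor22.ThetaVolumeDatumAt P l), letI := T.instFieldF; letI := T.instNumberFieldF; letI := T.instAlgebraF; letI := T.instFieldK;
        letI := T.instNumberFieldK; letI := T.instAlgebraK; letI := T.instFieldFbar; letI := T.instAlgebraFbar;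
        letI := T.instAlgebraKFbar; letI := T.instIsElliptic;
      ℤ → ∀ j : (thetaIndex (pilotDataOfK T.D T.K)).LabelStar, FinDivisor (M P l T) → ∀ vQ : (thetaIndex (pilotDataOfK T.D T.K)).VQ, Set ((logShellsDH (pilotDataOfK T.D T.K) (analyticLogv T.K)).Packet j.1 vQ))
    (n : ∀ (P : NFPoint) (l : ℕ) (T : Cor22.ThetaVolumeDatumAt P l), ℤ)
    {HT : ∀ (P : NFPoint) (l : ℕ) (T : Cor22.ThetaVolumeDatumAt P l), Type} {LogLink : ∀ (P : NFPoint) (l : ℕ) (T : Cor22.ThetaVolumeDatumAt P l), HT P l T → HT P l T → Type}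
    {IsFull : ∀ (P : NFPoint) (l : ℕ) (T : Cor22.ThetaVolumeDatumAt P l), ∀ {s t : HT P l T}, LogLink P l T s t → Prop}
    (lat : ∀ (P : NFPoint) (l : ℕ) (T : Cor22.ThetaVolumeDatumAt P l), LGPGaussianLogThetaLattice (LogLink P l T) (IsFull P l T))
    {Frd : ∀ (P : NFPoint) (l : ℕ) (T : Cor22.ThetaVolumeDatumAt P l), Type} {IsoF : ∀ (P : NFPoint) (l : ℕ) (T : Cor22.ThetaVolumeDatumAt P l), Frd P l T → Frd P l T → Type} {Ob : ∀ (P : NFPoint) (l : ℕ) (T : Cor22.ThetaVolumeDatumAt P l), Frd P l T → Type}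
    {realify : ∀ (P : NFPoint) (l : ℕ) (T : Cor22.ThetaVolumeDatumAt P l), Frd P l T → Frd P l T} {Strip : ∀ (P : NFPoint) (l : ℕ) (T : Cor22.ThetaVolumeDatumAt P l), Type} {IsoS : ∀ (P : NFPoint) (l : ℕ) (T : Cor22.ThetaVolumeDatumAt P l), Strip P l T → Strip P l T → Type}
    {Mv : ∀ (P : NFPoint) (l : ℕ) (T : Cor22.ThetaVolumeDatumAt P l), letI := T.instFieldF; letI := T.instNumberFieldF; letI := T.instAlgebraF; letI := T.instFieldK;
        letI := T.instNumberFieldK; letI := T.instAlgebraK; letI := T.instFieldFbar; letI := T.instAlgebraFbar;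
        letI := T.instAlgebraKFbar; letI := T.instIsElliptic;
      ∀ v : (thetaIndex (pilotDataOfK T.D T.K)).V, v ∈ (thetaIndex (pilotDataOfK T.D T.K)).Vbad → Type}
    [∀ P l T v h, Monoid (Mv P l T v h)]
    (sig : ∀ (P : NFPoint) (l : ℕ) (T : Cor22.ThetaVolumeDatumAt P l), letI := T.instFieldF; letI := T.instNumberFieldF; letI := T.instAlgebraF; letI := T.instFieldK;
        letI := T.instNumberFieldK; letI := T.instAlgebraK; letI := T.instFieldFbar; letI := T.instAlgebraFbar;
        letI := T.instAlgebraKFbar; letI := T.instIsElliptic;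
      GlobalLGPFrobenioidSignature (thetaIndex (pilotDataOfK T.D T.K)).lstar (thetaIndex (pilotDataOfK T.D T.K)).V (· ∈ (thetaIndex (pilotDataOfK T.D T.K)).Vbad) (Frd P l T) (IsoF P l T) (Ob P l T) (realify P l T)
        (Strip P l T) (IsoS P l T) (Mv P l T))
    (split : ∀ (P : NFPoint) (l : ℕ) (T : Cor22.ThetaVolumeDatumAt P l), SplittingMonoids (Mv P l T))
    {ObΔ : ∀ (P : NFPoint) (l : ℕ) (T : Cor22.ThetaVolumeDatumAt P l), Type} {N : ∀ (P : NFPoint) (l : ℕ) (T : Cor22.ThetaVolumeDatumAt P l), letI := T.instFieldF; letI := T.instNumberFieldF; letI := T.instAlgebraF; letI := T.instFieldK;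
        letI := T.instNumberFieldK; letI := T.instAlgebraK; letI := T.instFieldFbar; letI := T.instAlgebraFbar;
        letI := T.instAlgebraKFbar; letI := T.instIsElliptic;
      ∀ v : (thetaIndex (pilotDataOfK T.D T.K)).V, v ∈ (thetaIndex (pilotDataOfK T.D T.K)).Vbad → Type}
    [∀ P l T v h, Monoid (N P l T v h)] (qData : ∀ (P : NFPoint) (l : ℕ) (T : Cor22.ThetaVolumeDatumAt P l), QPilotData (ObΔ P l T) (N P l T))
    -- the FREE stratum: a cell set at every genuine datum
    (σ : ∀ (P : NFPoint) (l : ℕ) (T : Cor22.ThetaVolumeDatumAt P l), letI := T.instFieldF; letI := T.instNumberFieldF; letI := T.instAlgebraF; letI := T.instFieldK;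
        letI := T.instNumberFieldK; letI := T.instAlgebraK; letI := T.instFieldFbar; letI := T.instAlgebraFbar;
        letI := T.instAlgebraKFbar; letI := T.instIsElliptic;
      Set (Fin (thetaIndex (pilotDataOfK T.D T.K)).lstar × (thetaIndex (pilotDataOfK T.D T.K)).VQ))
    -- [LIC₁-bad] «S on Σ» at the Szpiro-bad admissible RATIONAL `(P, l)` (`λ ∈ ℚ`): the (xi-f) licence at the cells of `σ`, OUR hull, chosen ideles
    (hLic₁ : ∀ P : NFPoint, P ∈ UP → P.degree ≤ 1 → ∀ l : ℕ, l.Prime → 5 ≤ l →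
      Cor22.AdmitsCore P → Cor22.CondP2 P l → Cor22.CondP5 P l → Cor22.CondP6 P l →
      (((l : ℝ) + 5) / 4 < (Cor22.dmod P : ℝ) ∨
        6 * l * (((l : ℝ) + 5) - 4 * Cor22.dmod P) / (((l : ℝ) + 4) * ((l : ℝ) - 3))
            * (P.logDiff + (1 - 1 / (l : ℝ)) * Cor22.logCondAvoid P {2, l})
          + 6 * l * ((l : ℝ) + 5) / (((l : ℝ) + 4) * ((l : ℝ) - 3)) * Real.log Real.pi < Cor22.logQAvoid P {2, l}) →
      ∀ T : Cor22.ThetaVolumeDatumAt P l, letI := T.instFieldF; letI := T.instNumberFieldF; letI := T.instAlgebraF; letI := T.instFieldK;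
        letI := T.instNumberFieldK; letI := T.instAlgebraK; letI := T.instFieldFbar; letI := T.instAlgebraFbar;
        letI := T.instAlgebraKFbar; letI := T.instIsElliptic;
      LicenceOn
        (settingPrVolSharp (pilotDataOfK T.D T.K) (logvAnalytic_analyticLogv (F := T.K)) (M P l T) (archPk P l T) (archSub P l T) (Ψ P l T)
          (act P l T) (Mmod P l T) (region P l T) (n P l T) (lat P l T) (sig P l T) (split P l T) (qData P l T)
          (exists_realising_qIdeles_pilotDataOfK T.D).choose
          (exists_realising_thetaIdeles_pilotDataOfK T.D).choose
          (exists_realising_qIdeles_pilotDataOfK T.D).choose_spec.1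
          (exists_realising_qIdeles_pilotDataOfK T.D).choose_spec.2.1) (σ P l T))
    -- [MU₁-bad] the RELATIVE tolerance there: `B_triv(σᶜ) ≤ (1−μ₀)·T.gap + Tol(P,l)`, xi-1's `OffSigmaTolerance` VERBATIM
    (hMu₁ : ∀ P : NFPoint, P ∈ UP → P.degree ≤ 1 → ∀ l : ℕ, l.Prime → 5 ≤ l →
      Cor22.AdmitsCore P → Cor22.CondP2 P l → Cor22.CondP5 P l → Cor22.CondP6 P l →
      (((l : ℝ) + 5) / 4 < (Cor22.dmod P : ℝ) ∨
        6 * l * (((l : ℝ) + 5) - 4 * Cor22.dmod P) / (((l : ℝ) + 4) * ((l : ℝ) - 3))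
            * (P.logDiff + (1 - 1 / (l : ℝ)) * Cor22.logCondAvoid P {2, l})
          + 6 * l * ((l : ℝ) + 5) / (((l : ℝ) + 4) * ((l : ℝ) - 3)) * Real.log Real.pi < Cor22.logQAvoid P {2, l}) →
      ∀ T : Cor22.ThetaVolumeDatumAt P l, letI := T.instFieldF; letI := T.instNumberFieldF; letI := T.instAlgebraF; letI := T.instFieldK;
        letI := T.instNumberFieldK; letI := T.instAlgebraK; letI := T.instFieldFbar; letI := T.instAlgebraFbar;
        letI := T.instAlgebraKFbar; letI := T.instIsElliptic;
      OffSigmaTolerance (1 - μ₀) (tol P l) T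
        (offTrivialMass
          (settingPrVolSharp (pilotDataOfK T.D T.K) (logvAnalytic_analyticLogv (F := T.K)) (M P l T) (archPk P l T) (archSub P l T) (Ψ P l T)
          (act P l T) (Mmod P l T) (region P l T) (n P l T) (lat P l T) (sig P l T) (split P l T) (qData P l T)
          (exists_realising_qIdeles_pilotDataOfK T.D).choose
          (exists_realising_thetaIdeles_pilotDataOfK T.D).choose
          (exists_realising_qIdeles_pilotDataOfK T.D).choose_spec.1
          (exists_realising_qIdeles_pilotDataOfK T.D).choose_spec.2.1) (σ P l T)))
    {ρ : ℝ} (h0 : 0 < ρ) (h2 : ρ ≤ 1 / 2) :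
    ABCWithExponentOn {P : NFPoint | P.FarFromCusps ({2} : Finset ℕ) ρ} (1 / μ₀) :=
  Repair.RH.OffSigma.abcExpOn_farFromCusps_share_of_offBound_degOne hμ₀ hμ₁
    (fun P l T => letI := T.instFieldF; letI := T.instNumberFieldF; letI := T.instAlgebraF; letI := T.instFieldK;
        letI := T.instNumberFieldK; letI := T.instAlgebraK; letI := T.instFieldFbar; letI := T.instAlgebraFbar;
        letI := T.instAlgebraKFbar; letI := T.instIsElliptic;
      offTrivialMass
        (settingPrVolSharp (pilotDataOfK T.D T.K) (logvAnalytic_analyticLogv (F := T.K)) (M P l T) (archPk P l T) (archSub P l T) (Ψ P l T)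
          (act P l T) (Mmod P l T) (region P l T) (n P l T) (lat P l T) (sig P l T) (split P l T) (qData P l T)
          (exists_realising_qIdeles_pilotDataOfK T.D).choose
          (exists_realising_thetaIdeles_pilotDataOfK T.D).choose
          (exists_realising_qIdeles_pilotDataOfK T.D).choose_spec.1
          (exists_realising_qIdeles_pilotDataOfK T.D).choose_spec.2.1) (σ P l T))
    (fun P hP hdeg l hl h5 hcore hP2 hP5 h6 hbad T => by
      have h := cor312UpTo_offTrivialMass_of_licenceOn_chosen T (M P l T) (archPk P l T) (archSub P l T) (Ψ P l T) (act P l T)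
          (Mmod P l T) (region P l T) (n P l T) (lat P l T) (sig P l T) (split P l T) (qData P l T) (σ P l T)
        (hLic₁ P hP hdeg l hl h5 hcore hP2 hP5 h6 hbad T)
      linarith)
    (fun P hP hdeg l hl h5 hcore hP2 hP5 h6 hbad T => hMu₁ P hP hdeg l hl h5 hcore hP2 hP5 h6 hbad T) h0 h2

end Summit.ABC.IUTFork.Conditional.SigmaMass

end
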